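import Literature.Topology.FourManifolds.OneMaxBall
import Literature.Topology.FourManifolds.MorseCountClosed
import HarnessLib

/-!
# The Morse count of a sphere, and Alexander's theorem for heights with at most one saddle

Topic `Literature/Topology/FourManifolds`; fact seat of Alexander's theorem
(`provefact-Literature.Topology.FourManifolds.SphereEmbedding.schoenflies_exists_ball`, Schultens
(2014), Thm. 3.2.5).  **Everything in this file is proved; no definitions, no named facts.**

* `SphereMorseCount.morseCount_eq_relEuler` — for EVERY Morse function `f` on a closed
  `(n+1)`-manifold `X`, `Σ_{k ≤ n+1} (-1)^k #Crit_k(f) = χ(X)` (`relEuler ℤ ℤ X ∅`): the tree's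
  Morse equality `Cobordism.IsMorseFunction.relEuler_eq_sum_ncard` (Milnor 1965, §3, Thm. 7.4)
  read on the cobordism `(X; ∅, ∅)` (`Cobordism.ofClosed`) after an affine renormalisation of
  `f` into `(0, 1)`.
* `SphereMorseCount.morseCount_sphere` — on `𝕊ⁿ⁺¹ ⊆ ℝⁿ⁺²` the count is `1 + (-1)^{n+1}`
  (`χ(∂Dᵏ) = 1 - (-1)^k`, Hatcher 2002, Example 2.17, tree
  `finRelHomology_of_homeomorph_boundarySphere`); `morseCount_sphere_two`:
  `#min - #saddles + #max = 2` on `𝕊²`; `ncard_two_eq_one_or_ncard_zero_eq_one`: at most one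
  saddle forces a unique maximum or a unique minimum.
* `ExpHeight.exists_isSmoothEmbedding_image_sphere_of_ncard_index_one_le_one` — **Schultens'
  Thm. 3.2.5, cases `n = 0, 1` of the printed induction on the number of saddles** (PDF p. 44),
  sphere form: a smooth embedding `f : 𝕊² → ℝ³` whose height `⟪v, f ·⟫` is Morse with at most
  one saddle has `f(𝕊²) = e(𝕊²)` for a smooth embedding `e : ℝ³ → ℝ³` — by the count and the
  tree's `OneMaxBall` (`exists_isSmoothEmbedding_image_sphere_of_index_two_isMaxOn`) applied to
  `v` (unique maximum) or to `-v` (unique minimum).  This is the base of the induction of the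
  printed proof in the form the induction of the fact seat uses it.

## References

* J. Schultens, *Introduction to 3-Manifolds*, GSM 151 (2014), Thm. 3.2.5, proof, cases
  `n = 0, 1` (PDF p. 44). [Schultens2014]
* J. Milnor, *Lectures on the h-cobordism theorem*, Princeton (1965), §3, Thm. 7.4, proof of
  Thm. 9.1. [MilnorHCobordism1965]
* A. Hatcher, *Algebraic Topology*, CUP (2002), Example 2.17. [HatcherAT2002]
-/

open scoped RealInnerProductSpace Topology Manifold ContDiff
open Set Filter Metric Module Function
open Literature.AlgebraicTopology.SingularHomology

noncomputable section

namespace Literature.Topology.FourManifolds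

namespace SphereMorseCount

open HalfSpaceCharted

universe u

/-- Affine renormalisation of a continuous function on a compact space into `(0, 1)`.
[folklore] -/
theorem exists_affine_mem_Ioo {X : Type*} [TopologicalSpace X] [CompactSpace X] {f : X → ℝ}
    (hf : Continuous f) : ∃ a : ℝ, 0 < a ∧ ∃ b : ℝ, ∀ x, a * f x + b ∈ Ioo (0 : ℝ) 1 := by
  obtain ⟨M, hM⟩ := (isCompact_range hf).isBounded.bddAbove
  obtain ⟨m, hm⟩ := (isCompact_range hf).isBounded.bddBelow
  have hmM : ∀ x, m ≤ f x ∧ f x ≤ M := fun x => ⟨hm ⟨x, rfl⟩, hM ⟨x, rfl⟩⟩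
  by_cases hX : Nonempty X
  · obtain ⟨x₀⟩ := hX
    have hle : m ≤ M := (hmM x₀).1.trans (hmM x₀).2
    refine ⟨1 / (2 * (M - m + 1)), by positivity, 1 / 4 - m / (2 * (M - m + 1)), fun x => ?_⟩
    obtain ⟨h1, h2⟩ := hmM x
    have hpos : 0 < M - m + 1 := by linarith
    rw [mem_Ioo]
    constructor
    · have : 0 ≤ (f x - m) / (2 * (M - m + 1)) := by positivity
      have heq : 1 / (2 * (M - m + 1)) * f x + (1 / 4 - m / (2 * (M - m + 1))) =
          (f x - m) / (2 * (M - m + 1)) + 1 / 4 := by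
        field_simp
        ring
      rw [heq]
      linarith
    · have hlt : (f x - m) / (2 * (M - m + 1)) < 1 / 2 := by
        rw [div_lt_iff₀ (by positivity)]
        linarith
      have heq : 1 / (2 * (M - m + 1)) * f x + (1 / 4 - m / (2 * (M - m + 1))) =
          (f x - m) / (2 * (M - m + 1)) + 1 / 4 := by
        field_simp
        ring
      rw [heq]
      linarith
  · exact ⟨1, one_pos, 0, fun x => (hX ⟨x⟩).elim⟩

/-- **The Morse count of a closed manifold is its Euler characteristic, for every Morse
function** (Milnor 1965, §3 and Thm. 7.4; Hirsch 1976, Ch. 6 Thm. 3.5): for a Morse function `f`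
on a closed `(n+1)`-manifold `X`, `Σ_{k ≤ n+1} (-1)^k #Crit_k(f) = χ(X)` (`relEuler ℤ ℤ X ∅`).
Read through the cobordism `(X; ∅, ∅)` (`Cobordism.ofClosed`) after an affine renormalisation
of `f` into `(0, 1)`, by the tree's Morse equality
`Cobordism.IsMorseFunction.relEuler_eq_sum_ncard`. [cite: MilnorHCobordism1965, §3 (PDF p. 21) and Thm. 7.4 (PDF p. 48)] -/
theorem morseCount_eq_relEuler {n : ℕ} {X : Type u} [TopologicalSpace X] [T2Space X]
    [SecondCountableTopology X] [CompactSpace X] [ChartedSpace (EuclideanSpace ℝ (Fin (n + 1))) X]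
    [IsManifold (𝓡 (n + 1)) ∞ X] {f : X → ℝ} (hf : IsMorse (𝓡 (n + 1)) f) :
    ∑ k ∈ Finset.range (n + 2), (-1 : ℤ) ^ k * ((criticalSetOfIndex (𝓡 (n + 1)) f k).ncard : ℤ) =
      relEuler ℤ ℤ X ∅ := by
  obtain ⟨a, ha, b, hab⟩ := exists_affine_mem_Ioo hf.contMDiff.continuous
  set f₁ : X → ℝ := fun x => a * f x + b with hf₁def
  have hf₁ : IsMorse (𝓡 (n + 1)) f₁ := hf.const_mul_add ha.ne' b
  have hF : (Cobordism.ofClosed n X).IsMorseFunction (f₁ ∘ of.symm) :=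
    Cobordism.isMorseFunction_ofClosed_iff.2 ⟨hf₁, hab⟩
  have h := hF.relEuler_eq_sum_ncard ℤ ℤ
  rw [Module.finrank_self, Nat.cast_one, mul_one] at h
  have hcount : ∀ k, (criticalSetOfIndex (𝓡∂ (n + 1)) (M := (Cobordism.ofClosed n X).W)
      (f₁ ∘ of.symm) k).ncard = (criticalSetOfIndex (𝓡 (n + 1)) f k).ncard := fun k => by
    show (criticalSetOfIndex (𝓡∂ (n + 1)) (M := HalfSpaceCharted X) (f₁ ∘ of.symm) k).ncard = _
    rw [ncard_criticalSetOfIndex_eq (hf₁.contMDiff.of_le (by norm_cast)),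
      hf.criticalSetOfIndex_const_mul_add ha]
  have hrange : range (Cobordism.ofClosed n X).inl = (∅ : Set (HalfSpaceCharted X)) :=
    Set.range_eq_empty _
  -- the identity `X → HalfSpaceCharted X` as a homeomorphism
  let e : X ≃ₜ HalfSpaceCharted X :=
    { toEquiv := of, continuous_toFun := continuous_id, continuous_invFun := continuous_id }
  have hXW : relEuler ℤ ℤ X ∅ = relEuler ℤ ℤ (HalfSpaceCharted X) ∅ :=
    relEuler_eq_of_homeomorph e (Set.mapsTo_empty _ _) (Set.mapsTo_empty _ _)
  rw [hXW, ← relEuler_congr_set (R := ℤ) (M := ℤ) (X := HalfSpaceCharted X) hrange]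
  exact (h.trans (Finset.sum_congr rfl fun k _ => by rw [hcount k])).symm

/-- **The Morse count of a sphere**: for a Morse function `f` on the round sphere
`𝕊ⁿ⁺¹ ⊆ ℝⁿ⁺²`, `Σ_{k ≤ n+1} (-1)^k #Crit_k(f) = χ(𝕊ⁿ⁺¹) = 1 + (-1)^{n+1}` (Milnor 1965, §3;
Hirsch 1976, Ch. 6 Thm. 3.5; `χ(∂Dᵏ) = 1 - (-1)^k`, Hatcher 2002, Example 2.17).
[cite: MilnorHCobordism1965, §3 (PDF p. 21) and Thm. 7.4 (PDF p. 48)]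
[cite: HatcherAT2002, Example 2.17 (p. 118)] -/
theorem morseCount_sphere {n : ℕ} {f : sphere (0 : EuclideanSpace ℝ (Fin (n + 2))) 1 → ℝ}
    (hf : IsMorse (𝓡 (n + 1)) f) :
    ∑ k ∈ Finset.range (n + 2), (-1 : ℤ) ^ k * ((criticalSetOfIndex (𝓡 (n + 1)) f k).ncard : ℤ) =
      1 + (-1 : ℤ) ^ (n + 1) := by
  rw [morseCount_eq_relEuler hf,
    (finRelHomology_of_homeomorph_boundarySphere ℤ ℤ (boundarySphereHomeomorph (n + 2))).2,
    Module.finrank_self]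
  push_cast
  ring

/-- **The Morse count of the `2`-sphere**: a Morse function on `𝕊² ⊆ ℝ³` has
`#minima - #saddles + #maxima = 2` (critical points of index `0`, `1`, `2`).
[cite: MilnorHCobordism1965, §3 (PDF p. 21) and Thm. 7.4 (PDF p. 48)]
[cite: HatcherAT2002, Example 2.17 (p. 118)] -/
theorem morseCount_sphere_two {f : sphere (0 : EuclideanSpace ℝ (Fin 3)) 1 → ℝ}
    (hf : IsMorse (𝓡 2) f) :
    ((criticalSetOfIndex (𝓡 2) f 0).ncard : ℤ) - (criticalSetOfIndex (𝓡 2) f 1).ncard +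
      (criticalSetOfIndex (𝓡 2) f 2).ncard = 2 := by
  have h := morseCount_sphere (n := 1) hf
  simp only [Finset.sum_range_succ, Finset.sum_range_zero] at h
  norm_num at h
  linarith

/-- On `𝕊²`, a Morse function with at most one saddle has a unique maximum or a unique minimum:
`#minima + #maxima = 2 + #saddles ≤ 3` with both counts `≥ 1`. [folklore] -/
theorem ncard_two_eq_one_or_ncard_zero_eq_one {f : sphere (0 : EuclideanSpace ℝ (Fin 3)) 1 → ℝ}
    (hf : IsMorse (𝓡 2) f) (h1 : (criticalSetOfIndex (𝓡 2) f 1).ncard ≤ 1) :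
    (criticalSetOfIndex (𝓡 2) f 2).ncard = 1 ∨ (criticalSetOfIndex (𝓡 2) f 0).ncard = 1 := by
  have hcount := morseCount_sphere_two hf
  have h0 : 1 ≤ (criticalSetOfIndex (𝓡 2) f 0).ncard := hf.one_le_ncard_criticalSetOfIndex_zero
  have h2 : 1 ≤ (criticalSetOfIndex (𝓡 2) f 2).ncard := by
    have := hf.one_le_ncard_criticalSetOfIndex_finrank
    simpa [finrank_euclideanSpace_fin] using this
  omega

end SphereMorseCount

namespace ExpHeight

open SphereMorseCount

/-- **Schultens' Theorem 3.2.5 (Alexander's theorem), cases `n = 0` and `n = 1` of the printed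
induction, sphere form.**  Let `f : 𝕊² → ℝ³` be a smooth embedding and `v ≠ 0` a direction
whose height `⟪v, f ·⟫` is a Morse function with at most one saddle (critical point of index
`1`).  Then `f(𝕊²)` is the image of the unit sphere under a smooth embedding `ℝ³ → ℝ³` (so it
bounds a smooth ball on the side `e(𝔻³)`).  By the Morse count on `𝕊²`
(`SphereMorseCount.morseCount_sphere_two`: `#min - #saddles + #max = 2`) there is a unique maximum
or a unique minimum; in the first case `OneMaxBall`
(`exists_isSmoothEmbedding_image_sphere_of_index_two_isMaxOn`) applies to `v`, in the second to
`-v` (turning about exchanges minima and maxima, Milnor 1965, proof of Thm. 9.1).  Schultens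
(2014), proof of Thm. 3.2.5, PDF p. 44: "`n = 0`: … `h|S` has one maximum, one minimum, and no
saddle points … bounds a 3-ball"; "`n = 1`: … the saddle … cancels with a maximum or minimum".
[cite: Schultens2014, Thm. 3.2.5, proof, cases n = 0, 1 (PDF p. 44)] -/
theorem exists_isSmoothEmbedding_image_sphere_of_ncard_index_one_le_one
    {f : sphere (0 : EuclideanSpace ℝ (Fin 3)) 1 → EuclideanSpace ℝ (Fin 3)}
    (hf : Manifold.IsSmoothEmbedding (𝓡 2) 𝓘(ℝ, EuclideanSpace ℝ (Fin 3)) ∞ f)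
    {v : EuclideanSpace ℝ (Fin 3)} (hv : v ≠ 0) (hMorse : IsMorse (𝓡 2) fun y => ⟪v, f y⟫)
    (h1 : (criticalSetOfIndex (𝓡 2) (fun y => ⟪v, f y⟫) 1).ncard ≤ 1) :
    ∃ e : EuclideanSpace ℝ (Fin 3) → EuclideanSpace ℝ (Fin 3),
      Manifold.IsSmoothEmbedding (𝓡 3) (𝓡 3) ∞ e ∧ e '' sphere 0 1 = range f := by
  set h : sphere (0 : EuclideanSpace ℝ (Fin 3)) 1 → ℝ := fun y => ⟪v, f y⟫ with hdef
  have hfin : ∀ k, (criticalSetOfIndex (𝓡 2) h k).Finite := fun k =>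
    (IsMorse.finite_criticalSet_holds hMorse).subset (criticalSetOfIndex_subset _ h k)
  have hc : Continuous h := hMorse.contMDiff.continuous
  rcases ncard_two_eq_one_or_ncard_zero_eq_one hMorse h1 with h2 | h0
  · -- unique maximum: apply `OneMaxBall` to `v`
    obtain ⟨a, ha⟩ := Set.ncard_eq_one.1 h2
    obtain ⟨y₀, -, hy₀⟩ := isCompact_univ.exists_isMaxOn univ_nonempty hc.continuousOn
    have hmax₀ : IsLocalMax h y₀ := hy₀.isLocalMax univ_mem
    have hy₀mem : y₀ ∈ criticalSetOfIndex (𝓡 2) h 2 := by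
      refine ⟨IsLocalMax.isMCriticalPt hmax₀, ?_⟩
      have := hMorse.morseIndex_eq_finrank_of_isLocalMax hmax₀
      simpa [finrank_euclideanSpace_fin] using this
    refine exists_isSmoothEmbedding_image_sphere_of_index_two_isMaxOn hf hv hMorse
      fun y hy hidx y' => ?_
    have hymem : y ∈ criticalSetOfIndex (𝓡 2) h 2 := ⟨hy, hidx⟩
    rw [ha] at hymem hy₀mem
    rw [mem_singleton_iff] at hymem hy₀mem
    rw [hymem, ← hy₀mem]
    exact hy₀ (mem_univ y')
  · -- unique minimum: apply `OneMaxBall` to `-v`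
    obtain ⟨a, ha⟩ := Set.ncard_eq_one.1 h0
    obtain ⟨y₀, -, hy₀⟩ := isCompact_univ.exists_isMinOn univ_nonempty hc.continuousOn
    have hmin₀ : IsLocalMin h y₀ := hy₀.isLocalMin univ_mem
    have hy₀mem : y₀ ∈ criticalSetOfIndex (𝓡 2) h 0 :=
      ⟨IsLocalMin.isMCriticalPt hmin₀, hMorse.morseIndex_eq_zero_of_isLocalMin hmin₀⟩
    have hneg : (fun y => ⟪-v, f y⟫) = fun y => 0 - h y := by
      funext y
      simp [hdef, inner_neg_left]
    have hMorse' : IsMorse (𝓡 2) fun y => ⟪-v, f y⟫ := by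
      rw [hneg]
      exact hMorse.const_sub 0
    refine exists_isSmoothEmbedding_image_sphere_of_index_two_isMaxOn hf (neg_ne_zero.2 hv)
      hMorse' fun y hy hidx y' => ?_
    rw [hneg] at hy hidx
    have hd : MDifferentiableAt (𝓡 2) 𝓘(ℝ, ℝ) h y := hMorse.contMDiff.mdifferentiableAt (by simp)
    have hy' : IsMCriticalPt (𝓡 2) h y := (isMCriticalPt_const_sub_iff 0 hd).1 hy
    have hadd := hMorse.morseIndex_const_sub_add 0 hy'
    rw [hidx, finrank_euclideanSpace_fin] at hadd
    have hidx0 : morseIndex (𝓡 2) h y = 0 := by omega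
    have hymem : y ∈ criticalSetOfIndex (𝓡 2) h 0 := ⟨hy', hidx0⟩
    rw [ha] at hymem hy₀mem
    rw [mem_singleton_iff] at hymem hy₀mem
    have hle : h y ≤ h y' := by
      rw [hymem, ← hy₀mem]
      exact hy₀ (mem_univ y')
    have : ⟪-v, f y'⟫ = -h y' := by simp [hdef, inner_neg_left]
    have : ⟪-v, f y⟫ = -h y := by simp [hdef, inner_neg_left]
    linarith

end ExpHeight

end Literature.Topology.FourManifolds

end
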